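import Literature.NumberTheory.Automorphic.TwistedQuotientIntFunHeckeReduction
import HarnessLib

/-!
# Polynomials in Hecke operators on `M̃`, their reduction mod `n`, and the bound
# `Q(T)^{q+1} H^q(Γ, M̃) ⊆ n · H^q(Γ, M̃)`

Topic `NumberTheory/Automorphic`; namespace `Literature.NumberTheory.Automorphic.TwistedQuotient`.
Definitions with bodies and theorems; no named fact, no instance, no `sorry`.

Continuation of `TwistedQuotientIntFunHeckeReduction` (one Hecke operator) to noncommutative
polynomials `Q` in a family of Hecke operators `[L tᵢ L]`:

* `φZ_mul_hom_apply`, `φZ_add_hom_apply`, `φZ_neg_one_hom_apply` — `φ ↦ φZ W φ a` respects the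
  ring operations of `End W` (pointwise forms);
* `heckePolyInd t : FreeRing I →+* End (indFun (latticeRep M))`, evaluation at the transported
  Hecke operators `heckeIndHom (tᵢ)`;
* **`indFunIsoInvariants_indFunMod_heckePolyInd`** / **`heckePolyInd_comp_indFunMod_comp`** —
  for every `Q`, `Q(T_ind) ≫ indFunMod ≫ iso = indFunMod ≫ iso ≫ φZ (heckePolyTwist Q) 0`;
* **`exists_eq_nsmul_of_pow_map_φZ_eq_zero`** — if `φZ (heckePolyTwist Q) 0` acts on
  `H^q(Γ, W^{L/L'})` with `(q+1)`-st power `0` (the Hochschild–Serre conclusion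
  `TameLevel.pow_succ_map_φZ_heckePolyTower_eq_zero_of_heckeOperator`), and `n` is a
  non-zero-divisor on `M`, then `Q(T)^{q+1} x ∈ n · H^q(Γ, indFun (latticeRep M))` for every class
  `x` (Bockstein, `exists_eq_nsmul_of_map_indFunMod_eq_zero`).  This is
  "`(T − a)^N H^i(X_K, ℳ_{ξ,K}) ⊆ p^m H^i(X_K, ℳ_{ξ,K})`" in the proof of [Scholze2015, Thm. V.4.1].

## References

* P. Scholze, *On torsion in the cohomology of locally symmetric varieties*, Ann. of Math. 182
  (2015), §V.4, proof of Thm. V.4.1. [Scholze2015]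
-/

noncomputable section

open CategoryTheory Literature.Algebra.Homology
open scoped Classical

universe u

namespace Literature.NumberTheory.Automorphic

namespace TwistedQuotient

/-! ### `φZ` is compatible with the ring operations (pointwise forms) -/

section PhiZ

variable {k : Type u} [CommRing k] {Γ H : Type u} [Group Γ] [Group H] (W : Rep k (Γ × H))

/-- `φZ (φ * ψ)` acts as `φZ φ ∘ φZ ψ` (`*` of `End W` is reverse composition). [folklore] -/
theorem φZ_mul_hom_apply (φ ψ : End W) (a : ℕ) (f : hKerRep W a) :
    (φZ W (φ * ψ) a).hom f = (φZ W φ a).hom ((φZ W ψ a).hom f) :=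
  rfl

/-- `φZ (φ + ψ)` acts as `φZ φ + φZ ψ`. [folklore] -/
theorem φZ_add_hom_apply (φ ψ : End W) (a : ℕ) (f : hKerRep W a) :
    (φZ W (φ + ψ) a).hom f = (φZ W φ a).hom f + (φZ W ψ a).hom f :=
  rfl

/-- `φZ (-1)` acts as `-id`. [folklore] -/
theorem φZ_neg_one_hom_apply (a : ℕ) (f : hKerRep W a) :
    (φZ W (-1 : End W) a).hom f = -f :=
  rfl

end PhiZ

/-! ### Polynomials in the transported Hecke operators -/

variable {A : Type u} [CommRing A] {Γ 𝒢 : Type u} [Group Γ] [Group 𝒢] (ι : Γ →* 𝒢)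
  {L' L : Subgroup 𝒢} (hle : L' ≤ L)
  {V : Type u} [AddCommGroup V] [Module A V] (π : Representation A 𝒢 V)
  (M : Submodule A V) (hM : ∀ l ∈ L, ∀ m ∈ M, π l m ∈ M) (n : ℕ)
  {I : Type*} (t : I → 𝒢) (ht : ∀ i, π (t i) = 1)

/-- **Evaluation of noncommutative polynomials at the Hecke operators `[L tᵢ L]` transported to
`indFun (latticeRep M)`.** [folklore] -/
def heckePolyInd : FreeRing I →+* End (indFun ι L (latticeRep L π M hM)) :=
  FreeRing.lift fun i => heckeIndHom ι π M hM (rep_mem_of_eq_one π M (ht i))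

/-- `heckePolyInd` on a generator. [folklore] -/
@[simp]
theorem heckePolyInd_of (i : I) :
    heckePolyInd ι π M hM t ht (FreeRing.of i) = heckeIndHom ι π M hM (rep_mem_of_eq_one π M (ht i)) :=
  FreeRing.lift_of _ _

variable [hN : (L'.subgroupOf L).Normal]
  (hconjₜ : ∀ (i : I) (l : L), ∃ a ∈ L', ∃ b ∈ L', (l : 𝒢) * t i * (l : 𝒢)⁻¹ = a * t i * b)
  (hfinₜ : ∀ i, (ArithmeticQuotient.doubleCosetQuot L (t i)).Finite)
  (hfinₜ' : ∀ i, (ArithmeticQuotient.doubleCosetQuot L' (t i)).Finite)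
  (hbijₜ : ∀ i, Set.BijOn (Subgroup.quotientMapOfLE hle)
    (ArithmeticQuotient.doubleCosetQuot L' (t i)) (ArithmeticQuotient.doubleCosetQuot L (t i)))

/-- Ring operations of `End X` act pointwise (multiplication). [folklore] -/
theorem end_mul_hom_apply {X : Rep A Γ} (φ ψ : End X) (F : X) : (φ * ψ).hom F = φ.hom (ψ.hom F) :=
  rfl

/-- Ring operations of `End X` act pointwise (addition). [folklore] -/
theorem end_add_hom_apply {X : Rep A Γ} (φ ψ : End X) (F : X) : (φ + ψ).hom F = φ.hom F + ψ.hom F :=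
  rfl

/-- Ring operations of `End X` act pointwise (`-1`). [folklore] -/
theorem end_neg_one_hom_apply {X : Rep A Γ} (F : X) : (-1 : End X).hom F = -F :=
  rfl

include ht hfinₜ hbijₜ in
/-- **Reduction intertwines polynomials in the Hecke operators** (pointwise form): for every `Q`
and `F ∈ indFun (latticeRep M)`, `iso (Q(T_ind) F mod n) = φZ (heckePolyTwist Q) 0 (iso (F mod n))`
(from the generator case `heckeIndHom_comp_indFunMod_comp` by induction on `Q`).
[cite: Scholze2015, §V.4 (proof of Thm. V.4.1)] -/
theorem indFunIsoInvariants_indFunMod_heckePolyInd (hL' : ModTrivialOn π M hM n L') (Q : FreeRing I)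
    (F : indFun ι L (latticeRep L π M hM)) :
    (indFunIsoInvariants ι hle (modRep L (latticeRep L π M hM) n)
          (modRep_eq_one_of_modTrivialOn π M hM n hL')).hom.hom
        ((indFunMod ι L (latticeRep L π M hM) n).hom ((heckePolyInd ι π M hM t ht Q).hom F)) =
      (φZ (inducedLevelProd ι hle (modRep L (latticeRep L π M hM) n)
            (modRep_eq_one_of_modTrivialOn π M hM n hL'))
          (heckePolyTwist ι hle (1 : Representation A Γ (M ⧸ nsmulSubmodule (A := A) (N := M) n))
            (quotRep (modRep L (latticeRep L π M hM) n) (modRep_eq_one_of_modTrivialOn π M hM n hL'))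
            (commute_one_quotRep _ _) t hconjₜ hfinₜ' Q) 0).hom
        ((indFunIsoInvariants ι hle (modRep L (latticeRep L π M hM) n)
          (modRep_eq_one_of_modTrivialOn π M hM n hL')).hom.hom
          ((indFunMod ι L (latticeRep L π M hM) n).hom F)) := by
  induction Q using FreeRing.induction_on generalizing F with
  | hn1 =>
    rw [map_neg, map_one, map_neg, map_one, end_neg_one_hom_apply, φZ_neg_one_hom_apply, map_neg,
      map_neg]
  | hb i =>
    rw [heckePolyInd_of, heckePolyTwist_of]
    have h := heckeIndHom_comp_indFunMod_comp ι hle π M hM n (ht i) (hconjₜ i) hL' (hbijₜ i)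
      (hfinₜ i) (hfinₜ' i)
    exact congrArg (fun φ' : indFun ι L (latticeRep L π M hM) ⟶ _ => φ'.hom F) h
  | ha Q₁ Q₂ h₁ h₂ =>
    rw [map_add, map_add, end_add_hom_apply, φZ_add_hom_apply, map_add, map_add, h₁, h₂]
  | hm Q₁ Q₂ h₁ h₂ =>
    rw [map_mul, map_mul, end_mul_hom_apply, φZ_mul_hom_apply, h₁, h₂]

include ht hfinₜ hbijₜ in
/-- The same as an identity of morphisms `indFun (latticeRep M) ⟶ W^{L/L'}`:
`Q(T_ind) ≫ indFunMod ≫ iso = indFunMod ≫ iso ≫ φZ (heckePolyTwist Q) 0`.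
[cite: Scholze2015, §V.4 (proof of Thm. V.4.1)] -/
theorem heckePolyInd_comp_indFunMod_comp (hL' : ModTrivialOn π M hM n L') (Q : FreeRing I) :
    (show indFun ι L (latticeRep L π M hM) ⟶ indFun ι L (latticeRep L π M hM) from
        heckePolyInd ι π M hM t ht Q) ≫ indFunMod ι L (latticeRep L π M hM) n ≫
        (indFunIsoInvariants ι hle (modRep L (latticeRep L π M hM) n)
          (modRep_eq_one_of_modTrivialOn π M hM n hL')).hom =
      indFunMod ι L (latticeRep L π M hM) n ≫
        (indFunIsoInvariants ι hle (modRep L (latticeRep L π M hM) n)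
          (modRep_eq_one_of_modTrivialOn π M hM n hL')).hom ≫
        φZ (inducedLevelProd ι hle (modRep L (latticeRep L π M hM) n)
            (modRep_eq_one_of_modTrivialOn π M hM n hL'))
          (heckePolyTwist ι hle (1 : Representation A Γ (M ⧸ nsmulSubmodule (A := A) (N := M) n))
            (quotRep (modRep L (latticeRep L π M hM) n) (modRep_eq_one_of_modTrivialOn π M hM n hL'))
            (commute_one_quotRep _ _) t hconjₜ hfinₜ' Q) 0 :=
  Rep.hom_ext (Representation.IntertwiningMap.ext (LinearMap.ext fun F =>
    indFunIsoInvariants_indFunMod_heckePolyInd ι hle π M hM n t ht hconjₜ hfinₜ hfinₜ' hbijₜ hL' Q F))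

/-! ### The bound on cohomology -/

/-- Evaluation of a composite of morphisms of `ModuleCat` (three factors). [folklore] -/
private theorem functor_map_comp₃_apply {X Y Z T : Rep A Γ} (f : X ⟶ Y) (g : Y ⟶ Z) (h : Z ⟶ T)
    (q : ℕ) (x : groupCohomology X q) :
    ((groupCohomology.functor A Γ q).map (f ≫ g ≫ h)) x =
      ((groupCohomology.functor A Γ q).map h) (((groupCohomology.functor A Γ q).map g)
        (((groupCohomology.functor A Γ q).map f) x)) := by
  rw [Functor.map_comp, Functor.map_comp, ModuleCat.comp_apply, ModuleCat.comp_apply]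

include ht hfinₜ hbijₜ in
/-- **`Q(T)^{q+1} H^q(Γ, M̃) ⊆ n · H^q(Γ, M̃)`** when `Q(T)` acts on `H^q(Γ, W^{L/L'})`
(`W = Fun(𝒢/L', M/n)`) with vanishing `(q+1)`-st power — the conclusion of the Hochschild–Serre step
(`TameLevel.pow_succ_map_φZ_heckePolyTower_eq_zero_of_heckeOperator`) — and `n` is a
non-zero-divisor on `M` (Bockstein). [cite: Scholze2015, §V.4 (proof of Thm. V.4.1)] -/
theorem exists_eq_nsmul_of_pow_map_φZ_eq_zero (hL' : ModTrivialOn π M hM n L')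
    (hn : Function.Injective fun m : M => (n : A) • m) (Q : FreeRing I) (q : ℕ)
    (hQ : ((groupCohomology.functor A Γ q).map
        (φZ (inducedLevelProd ι hle (modRep L (latticeRep L π M hM) n)
            (modRep_eq_one_of_modTrivialOn π M hM n hL'))
          (heckePolyTwist ι hle (1 : Representation A Γ (M ⧸ nsmulSubmodule (A := A) (N := M) n))
            (quotRep (modRep L (latticeRep L π M hM) n) (modRep_eq_one_of_modTrivialOn π M hM n hL'))
            (commute_one_quotRep _ _) t hconjₜ hfinₜ' Q) 0)).hom ^ (q + 1) = 0)
    (x : groupCohomology (indFun ι L (latticeRep L π M hM)) q) :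
    ∃ y : groupCohomology (indFun ι L (latticeRep L π M hM)) q,
      (((groupCohomology.functor A Γ q).map
          (show indFun ι L (latticeRep L π M hM) ⟶ indFun ι L (latticeRep L π M hM) from
            heckePolyInd ι π M hM t ht Q)).hom ^ (q + 1)) x =
        n • y := by
  -- notation
  set iso := indFunIsoInvariants ι hle (modRep L (latticeRep L π M hM) n)
    (modRep_eq_one_of_modTrivialOn π M hM n hL')
  set φQ := φZ (inducedLevelProd ι hle (modRep L (latticeRep L π M hM) n)
      (modRep_eq_one_of_modTrivialOn π M hM n hL'))
    (heckePolyTwist ι hle (1 : Representation A Γ (M ⧸ nsmulSubmodule (A := A) (N := M) n))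
      (quotRep (modRep L (latticeRep L π M hM) n) (modRep_eq_one_of_modTrivialOn π M hM n hL'))
      (commute_one_quotRep _ _) t hconjₜ hfinₜ' Q) 0
  set T := ((groupCohomology.functor A Γ q).map
    (show indFun ι L (latticeRep L π M hM) ⟶ indFun ι L (latticeRep L π M hM) from
      heckePolyInd ι π M hM t ht Q)).hom
  set F := ((groupCohomology.functor A Γ q).map (indFunMod ι L (latticeRep L π M hM) n)).hom
  set J := ((groupCohomology.functor A Γ q).map iso.hom).hom
  set Z := ((groupCohomology.functor A Γ q).map φQ).hom
  -- one step of naturality, from the identity of morphisms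
  have hnat : ∀ z, J (F (T z)) = Z (J (F z)) := fun z => by
    have h := congrArg (fun φ' => ((groupCohomology.functor A Γ q).map φ') z)
      (heckePolyInd_comp_indFunMod_comp ι hle π M hM n t ht hconjₜ hfinₜ hfinₜ' hbijₜ hL' Q)
    simp only at h
    rw [functor_map_comp₃_apply, functor_map_comp₃_apply] at h
    exact h
  -- all powers
  have hpow : ∀ (m : ℕ) (z), J (F ((T ^ m) z)) = (Z ^ m) (J (F z)) := by
    intro m
    induction m with
    | zero => intro z; simp
    | succ m ih => intro z; rw [pow_succ, pow_succ, Module.End.mul_apply, Module.End.mul_apply, ih, hnat]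
  -- `Z ^ (q+1) = 0`
  have hZ : Z ^ (q + 1) = 0 := hQ
  -- `J` is injective (it has the left inverse `H^q(iso⁻¹)`)
  have hJ : Function.Injective J := by
    intro a b hab
    have h := congrArg ((groupCohomology.functor A Γ q).map iso.inv).hom hab
    have hid : ∀ c, ((groupCohomology.functor A Γ q).map iso.inv).hom (J c) = c := fun c => by
      change ((groupCohomology.functor A Γ q).map iso.hom ≫ (groupCohomology.functor A Γ q).map iso.inv) c = c
      rw [← Functor.map_comp, Iso.hom_inv_id, CategoryTheory.Functor.map_id]
      rfl
    rwa [hid, hid] at h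
  -- conclude by Bockstein
  refine exists_eq_nsmul_of_map_indFunMod_eq_zero ι L (latticeRep L π M hM) n hn q _ (hJ ?_)
  change J (F ((T ^ (q + 1)) x)) = J 0
  rw [hpow, hZ, LinearMap.zero_apply, map_zero]

end TwistedQuotient

end Literature.NumberTheory.Automorphic
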